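/-
Copyright (c) 2026 the pub-hodgecm-mathlib formalisation cell (harness21).  Prover seat hodgecm-mathlib-LH7-p08 (g0), re-dealt by director s1969 (a) to strike line L3
`stub_N6nsDyadic`, Track A «(D-RAM) FOUR-FRAME» squad, helper lane on h413 = stmt-HodgeConjecture-24833 (count-neutral).  β-table board (sub-dealer LH4-p05 (g8), heir LEAD
T20-16): TOWER-SIGN RELATIONS II + III — the datum discharge of F0P3a-p01 (g37)'s `OddLabelledBoxSum` (T1) v0 binders `hrel2` ∕ `hrel1` (and `hrel3`) in the deep range.  2026-09-04.
-/
import Summits.HodgeConjecture.HodgeConjecture.Theorems.F0P3cDyRamTowerSignRelations           -- ★ (LH4-p05 (g8)): RELATION I `normSign_towerSign_eq_of_sub_deep`; brings ★ `…TowerSignToken`, `mstarOfRecord`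
import Literature.NumberTheory.LocalFields.WildQuadraticDatumNormSignConductor                  -- ★ `normSign_mul_of_fixed` (`ω` multiplicative on the non-zero fixed elements)
import HarnessLib

/-!
# Crux `H413`, line LH4 «(D-RAM) FOUR-FRAME» — TOWER-SIGN RELATIONS, II + III: the token of `β − α` against the tokens of `β − 1` and `α − 1` when the THIRD root is deep
# (`ω(e_C) = ω(e_B)` on the key `(m, L, m)`, `ω(e_C) = ω(−1)·ω(e_A)` on the key `(L, m, m)`, `L − m ≥ 2d − 1`), and the three relations in ELEMENT-DATUM form

Cell `hodgecm-mathlib` (D-0151), FLOOR 0, crux item H413 = `stmt-HodgeConjecture-24833`, route `HCCMUnconditional`; squad F0∕P3c∕LH4.  THEOREMS ONLY (no `def`, no instance, no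
notation, no `sorry`, default heartbeats); ★-only imports; lane `--supports stmt-HodgeConjecture-24833 --as helper`; pays NO row, states NO law.

WHY (F0P3a-p01 (g37) ODDBOX-ORACLE v1 bdcd8809 §3; (T1) v0 `F0P3cDyRamOddLabelledBoxSumDefs.OddLabelledBoxSum` 77d1a77d).  The (β) table identity is an identity in
`(q, d, n₁, n₂, n₃, ω_A, ω_B, ω_C)` where `ω_A, ω_B, ω_C` are the norm signs of the tower-sign tokens `e_A, e_B, e_C` of `α − 1`, `β − 1`, `β − α` (★ `F0P3cDyRamTowerSignToken`;
letters `(n₁, n₂, n₃) = (v(β−1), v(α−1), v(α−β))`).  (T1) v0 carries three token relations as binders, each on an isosceles key whose third root is deep (`+ 2d`):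
`hrel3 : n₁ = n₂ → n₁ + 2d ≤ n₃ → ω_B = ω_A` (LH4-p05 (g8)'s ★ RELATION I `normSign_towerSign_eq_of_sub_deep`: the tokens of `α − 1` and `β − 1` differ by the deep `β − α`),
`hrel2 : n₁ = n₃ → n₁ + 2d ≤ n₂ → ω_C = ω_B` and `hrel1 : n₂ = n₃ → n₂ + 2d ≤ n₁ → ω_C = ω(−1)·ω_A`.  This file proves II and III as COROLLARIES of I — the token
congruence `|(ϖ^{m*})⁻¹·(x·((ϖσϖ)^k)⁻¹ − e·t₊)| ≤ 1` is a statement about the pair `(x, e)`, odd under `(x, e) ↦ (−x, −e)`, so RELATION I applied to the pairs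
`(β − α, β − 1)` (difference `α − 1`) and `(−(α − 1), β − α)` (difference `β − 1`) gives `ω(e_C) = ω(e_B)` resp. `ω(e_C) = ω(−e_A) = ω(−1)·ω(e_A)` (★ `normSign_mul_of_fixed`) —
and then restates all three in ELEMENT-DATUM form (★ `IsElementDatum σ ϖ N₀ α β n₁ n₂ n₃` supplies `|β − 1| = |ϖ|^{n₁}`, `|α − 1| = |ϖ|^{n₂}`, `|α − β| = |ϖ|^{n₃}`), each token at
ITS OWN depth letter exactly as the ★ tower rows bind it (`e_A` at `n₂` — ★ p860780 `heA`; `e_B` at `n₁` — ★ p860780 `heB`; `e_C` at `n₃` — ★ p860897 `heC`), so that the (T2)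
TRUNK `…LabelledOddStageBTable.hbox_of_oddBoxSum` discharges `hrel1 ∕ hrel2 ∕ hrel3` of (T1) in one term each.
* §1 `normSign_towerSign_sub_eq_of_fst_deep` (II, abstract) · `normSign_towerSign_sub_eq_neg_mul_of_snd_deep` (III, abstract).
* §2 `normSign_towerSign_eq_of_isElementDatum_of_deep₃` (`hrel3`) · `…_of_deep₂` (`hrel2`) · `…_of_deep₁` (`hrel1`).
NOT HERE: the shallow keys `L − m ≤ 2d − 2` (there the relation is a genuine datum — forced at `q = 2`, free at `q ≥ 4` where the `H`-row pays: ORACLE §3, (T1) `hrel0` ∕ (P5)).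
HONEST LABEL.  Count-neutral arithmetic helper; table∕(β-BAL)∕(β)∕T₊ row OPEN; `HC_CM` is proved only modulo the 7 printed citations (2 remaining named inputs: hLiu418 =
`stmt-HodgeConjecture-24832`, h413 = `stmt-HodgeConjecture-24833`) until rung 0 closes.

## References
* [Serre1979] J.-P. Serre, *Local Fields*, GTM 67 (1979), Ch. V §3 (conductor of a ramified quadratic extension; norm classes of units), Cor. 3.
* [Rogawski1990] J. D. Rogawski, *Automorphic Representations of Unitary Groups in Three Variables*, Ann. of Math. Stud. 123 (1990), §4.9 p. 55.
-/

set_option autoImplicit false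

noncomputable section

namespace Summit.HodgeConjecture.HodgeConjecture.Cruxes.H413.F0P3cDyRamTowerSignRelationsDeep

open Literature.NumberTheory.Automorphic Literature.NumberTheory.Automorphic.UnitaryThreeFourFrame
open Literature.NumberTheory.LocalFields Literature.NumberTheory.LocalFields.WildQuadraticDatum
open Summit.HodgeConjecture.HodgeConjecture.Cruxes.H413.F0P3cDyRamFourFramePieces
open Summit.HodgeConjecture.HodgeConjecture.Cruxes.H413.F0P3cDyRamStageOneBDefs
open Summit.HodgeConjecture.HodgeConjecture.Cruxes.H413.F0P3cDyRamTowerSignToken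
open Summit.HodgeConjecture.HodgeConjecture.Cruxes.H413.F0P3cDyRamTowerSignRelations
open WithZero
open scoped Valued

variable {K : Type} [Field K] [Valued K ℤᵐ⁰]

/-! ## §1  The token of `β − α` against one tower token when the other root is deep (abstract keys) -/

/-- **RELATION II — `ω(e_C) = ω(e_B)` WHEN `α − 1` IS DEEP.**  At a ramified datum on a complete field, let `eB`, `eC` be tower-sign tokens (σ-fixed units, the `ϖ^{m*}`-congruence
of ★ `F0P3cDyRamTowerSignToken` §1) of `β − 1` and of `β − α` at the SAME depth parameter `n ≡ d (mod 2)`, and suppose `|α − 1| ≤ |ϖ|^L` with `n + 2d ≤ L + 1`.  Then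
`normSign σ eC = normSign σ eB` — ★ RELATION I for the pair `(β − α, β − 1)`, whose difference is `α − 1`.  (Isosceles key `(n₁, n₂, n₃) = (m, L, m)`, `L − m ≥ 2d − 1`.)
[cite: Serre1979, Ch. V §3 Cor. 3] [cite: Rogawski1990, §4.9 p. 55] -/
theorem normSign_towerSign_sub_eq_of_fst_deep [CompleteSpace K] {σ : K →+* K} {ϖ : K} {d t : ℕ} (hD : IsRamifiedQuadraticDatum σ ϖ d t)
    {α β : K} {n L : ℕ} (hvα : Valued.v (α - 1) ≤ Valued.v ϖ ^ L) (hL : n + 2 * d ≤ L + 1) (hpar : n % 2 = d % 2)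
    {eB eC : K} (hσeB : σ eB = eB) (hσeC : σ eC = eC) (heC1 : Valued.v eC = 1)
    (heB : Valued.v ((ϖ ^ mstarOfRecord d)⁻¹ * ((β - 1) * ((ϖ * σ ϖ) ^ ((n - d % 2) / 2))⁻¹ - eB * ((ϖ - σ ϖ) * ((ϖ * σ ϖ) ^ ((d - d % 2) / 2))⁻¹))) ≤ 1)
    (heC : Valued.v ((ϖ ^ mstarOfRecord d)⁻¹ * ((β - α) * ((ϖ * σ ϖ) ^ ((n - d % 2) / 2))⁻¹ - eC * ((ϖ - σ ϖ) * ((ϖ * σ ϖ) ^ ((d - d % 2) / 2))⁻¹))) ≤ 1) :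
    normSign σ eC = normSign σ eB := by
  -- RELATION I at `(α, β) ↦ (β − α + 1, β)`: the first root is `β − α`, the second `β − 1`, their difference `β − (β − α + 1) = α − 1` is deep.
  have hv : Valued.v (β - (β - α + 1)) ≤ Valued.v ϖ ^ L := by
    have h : β - (β - α + 1) = α - 1 := by ring
    rw [h]; exact hvα
  have heC' : Valued.v ((ϖ ^ mstarOfRecord d)⁻¹ *
      ((β - α + 1 - 1) * ((ϖ * σ ϖ) ^ ((n - d % 2) / 2))⁻¹ - eC * ((ϖ - σ ϖ) * ((ϖ * σ ϖ) ^ ((d - d % 2) / 2))⁻¹))) ≤ 1 := by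
    have h : β - α + 1 - 1 = β - α := by ring
    rw [h]; exact heC
  exact (normSign_towerSign_eq_of_sub_deep hD hv hL hpar hσeC heC1 hσeB heC' heB).symm

/-- **RELATION III — `ω(e_C) = ω(−1)·ω(e_A)` WHEN `β − 1` IS DEEP.**  At a ramified datum on a complete field with finite residue field, let `eA`, `eC` be tower-sign tokens of
`α − 1` and of `β − α` at the SAME depth parameter `n ≡ d (mod 2)`, and suppose `|β − 1| ≤ |ϖ|^L` with `n + 2d ≤ L + 1`.  Then `normSign σ eC = normSign σ (−1) * normSign σ eA`:
`−eA` is a token of `−(α − 1)` (the congruence is odd in the pair), ★ RELATION I for the pair `(−(α − 1), β − α)` (difference `β − 1`) gives `ω(eC) = ω(−eA)`, and `ω` is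
multiplicative on the non-zero fixed elements (★ `normSign_mul_of_fixed`).  (Isosceles key `(n₁, n₂, n₃) = (L, m, m)`, `L − m ≥ 2d − 1`.)
[cite: Serre1979, Ch. V §3 Cor. 3] [cite: Rogawski1990, §4.9 p. 55] -/
theorem normSign_towerSign_sub_eq_neg_mul_of_snd_deep [CompleteSpace K] [Finite 𝓀[K]] {σ : K →+* K} {ϖ : K} {d t : ℕ} (hD : IsRamifiedQuadraticDatum σ ϖ d t)
    {α β : K} {n L : ℕ} (hvβ : Valued.v (β - 1) ≤ Valued.v ϖ ^ L) (hL : n + 2 * d ≤ L + 1) (hpar : n % 2 = d % 2)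
    {eA eC : K} (hσeA : σ eA = eA) (heA1 : Valued.v eA = 1) (hσeC : σ eC = eC)
    (heA : Valued.v ((ϖ ^ mstarOfRecord d)⁻¹ * ((α - 1) * ((ϖ * σ ϖ) ^ ((n - d % 2) / 2))⁻¹ - eA * ((ϖ - σ ϖ) * ((ϖ * σ ϖ) ^ ((d - d % 2) / 2))⁻¹))) ≤ 1)
    (heC : Valued.v ((ϖ ^ mstarOfRecord d)⁻¹ * ((β - α) * ((ϖ * σ ϖ) ^ ((n - d % 2) / 2))⁻¹ - eC * ((ϖ - σ ϖ) * ((ϖ * σ ϖ) ^ ((d - d % 2) / 2))⁻¹))) ≤ 1) :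
    normSign σ eC = normSign σ (-1 : K) * normSign σ eA := by
  -- RELATION I at `(α, β) ↦ (2 − α, β − α + 1)` with first token `−eA`: roots `1 − α = −(α − 1)` and `β − α`, difference `(β − α + 1) − (2 − α) = β − 1` deep.
  have hv : Valued.v (β - α + 1 - (2 - α)) ≤ Valued.v ϖ ^ L := by
    have h : β - α + 1 - (2 - α) = β - 1 := by ring
    rw [h]; exact hvβ
  have hσeA' : σ (-eA) = -eA := by rw [map_neg, hσeA]
  have heA1' : Valued.v (-eA) = 1 := by rw [Valuation.map_neg, heA1]
  have heA' : Valued.v ((ϖ ^ mstarOfRecord d)⁻¹ *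
      ((2 - α - 1) * ((ϖ * σ ϖ) ^ ((n - d % 2) / 2))⁻¹ - -eA * ((ϖ - σ ϖ) * ((ϖ * σ ϖ) ^ ((d - d % 2) / 2))⁻¹))) ≤ 1 := by
    have h : (ϖ ^ mstarOfRecord d)⁻¹ * ((2 - α - 1) * ((ϖ * σ ϖ) ^ ((n - d % 2) / 2))⁻¹ - -eA * ((ϖ - σ ϖ) * ((ϖ * σ ϖ) ^ ((d - d % 2) / 2))⁻¹)) =
        -((ϖ ^ mstarOfRecord d)⁻¹ * ((α - 1) * ((ϖ * σ ϖ) ^ ((n - d % 2) / 2))⁻¹ - eA * ((ϖ - σ ϖ) * ((ϖ * σ ϖ) ^ ((d - d % 2) / 2))⁻¹))) := by ring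
    rw [h, Valuation.map_neg]; exact heA
  have heC' : Valued.v ((ϖ ^ mstarOfRecord d)⁻¹ *
      ((β - α + 1 - 1) * ((ϖ * σ ϖ) ^ ((n - d % 2) / 2))⁻¹ - eC * ((ϖ - σ ϖ) * ((ϖ * σ ϖ) ^ ((d - d % 2) / 2))⁻¹))) ≤ 1 := by
    have h : β - α + 1 - 1 = β - α := by ring
    rw [h]; exact heC
  have hI := normSign_towerSign_eq_of_sub_deep hD hv hL hpar hσeA' heA1' hσeC heA' heC'
  -- `ω(−eA) = ω(−1)·ω(eA)`
  have hσ1 : σ (-1 : K) = -1 := by rw [map_neg, map_one]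
  have heA0 : eA ≠ 0 := fun h => by rw [h, map_zero] at heA1; exact zero_ne_one heA1
  rw [hI, ← neg_one_mul eA, normSign_mul_of_fixed hD hσ1 hσeA (neg_ne_zero.2 one_ne_zero) heA0]

/-! ## §2  The three relations in ELEMENT-DATUM form, each token at its own depth letter (the (T2) TRUNK's discharge of (T1) `hrel3 ∕ hrel2 ∕ hrel1`) -/

section ElementDatum

variable [CompleteSpace K] {σ : K →+* K} {ϖ : K} {d t : ℕ} {α β : K} {N₀ n₁ n₂ n₃ : ℕ}

/-- **(T1) `hrel3` FROM THE DATUM — `ω_B = ω_A` on the key `n₁ = n₂`, `n₁ + 2d ≤ n₃`.**  For an element datum `(α, β; n₁, n₂, n₃)` (so `|α − β| = |ϖ|^{n₃}`), tokens `eA` of `α − 1`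
at depth `n₂` and `eB` of `β − 1` at depth `n₁` (★ p860780's `heA` ∕ `heB` verbatim), `n₁ = n₂ ≡ d (mod 2)` and `n₁ + 2d ≤ n₃`: `normSign σ eB = normSign σ eA` — ★ RELATION I.
[cite: Serre1979, Ch. V §3 Cor. 3] [cite: Rogawski1990, §4.9 p. 55] -/
theorem normSign_towerSign_eq_of_isElementDatum_of_deep₃ (hD : IsRamifiedQuadraticDatum σ ϖ d t) (hE : IsElementDatum σ ϖ N₀ α β n₁ n₂ n₃)
    (h12 : n₁ = n₂) (hdeep : n₁ + 2 * d ≤ n₃) (hpar : n₁ % 2 = d % 2)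
    {eA eB : K} (hσeA : σ eA = eA) (heA1 : Valued.v eA = 1) (hσeB : σ eB = eB)
    (heA : Valued.v ((ϖ ^ mstarOfRecord d)⁻¹ * ((α - 1) * ((ϖ * σ ϖ) ^ ((n₂ - d % 2) / 2))⁻¹ - eA * ((ϖ - σ ϖ) * ((ϖ * σ ϖ) ^ ((d - d % 2) / 2))⁻¹))) ≤ 1)
    (heB : Valued.v ((ϖ ^ mstarOfRecord d)⁻¹ * ((β - 1) * ((ϖ * σ ϖ) ^ ((n₁ - d % 2) / 2))⁻¹ - eB * ((ϖ - σ ϖ) * ((ϖ * σ ϖ) ^ ((d - d % 2) / 2))⁻¹))) ≤ 1) :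
    normSign σ eB = normSign σ eA := by
  have hvβα : Valued.v (β - α) ≤ Valued.v ϖ ^ n₃ := le_of_eq (by rw [Valuation.map_sub_swap, hE.2.2.2.2.2.2.2.1])
  have hL : n₂ + 2 * d ≤ n₃ + 1 := by omega
  have hpar' : n₂ % 2 = d % 2 := h12 ▸ hpar
  rw [h12] at heB
  exact normSign_towerSign_eq_of_sub_deep hD hvβα hL hpar' hσeA heA1 hσeB heA heB

/-- **(T1) `hrel2` FROM THE DATUM — `ω_C = ω_B` on the key `n₁ = n₃`, `n₁ + 2d ≤ n₂`.**  For an element datum `(α, β; n₁, n₂, n₃)` (so `|α − 1| = |ϖ|^{n₂}`), tokens `eB` of `β − 1`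
at depth `n₁` and `eC` of `β − α` at depth `n₃` (★ p860780 `heB` ∕ ★ p860897 `heC` verbatim), `n₁ = n₃ ≡ d (mod 2)` and `n₁ + 2d ≤ n₂`: `normSign σ eC = normSign σ eB` — §1 RELATION II.
[cite: Serre1979, Ch. V §3 Cor. 3] [cite: Rogawski1990, §4.9 p. 55] -/
theorem normSign_towerSign_eq_of_isElementDatum_of_deep₂ (hD : IsRamifiedQuadraticDatum σ ϖ d t) (hE : IsElementDatum σ ϖ N₀ α β n₁ n₂ n₃)
    (h13 : n₁ = n₃) (hdeep : n₁ + 2 * d ≤ n₂) (hpar : n₁ % 2 = d % 2)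
    {eB eC : K} (hσeB : σ eB = eB) (hσeC : σ eC = eC) (heC1 : Valued.v eC = 1)
    (heB : Valued.v ((ϖ ^ mstarOfRecord d)⁻¹ * ((β - 1) * ((ϖ * σ ϖ) ^ ((n₁ - d % 2) / 2))⁻¹ - eB * ((ϖ - σ ϖ) * ((ϖ * σ ϖ) ^ ((d - d % 2) / 2))⁻¹))) ≤ 1)
    (heC : Valued.v ((ϖ ^ mstarOfRecord d)⁻¹ * ((β - α) * ((ϖ * σ ϖ) ^ ((n₃ - d % 2) / 2))⁻¹ - eC * ((ϖ - σ ϖ) * ((ϖ * σ ϖ) ^ ((d - d % 2) / 2))⁻¹))) ≤ 1) :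
    normSign σ eC = normSign σ eB := by
  have hvα : Valued.v (α - 1) ≤ Valued.v ϖ ^ n₂ := le_of_eq hE.2.2.2.2.2.2.1
  have hL : n₁ + 2 * d ≤ n₂ + 1 := by omega
  rw [← h13] at heC
  exact normSign_towerSign_sub_eq_of_fst_deep hD hvα hL hpar hσeB hσeC heC1 heB heC

/-- **(T1) `hrel1` FROM THE DATUM — `ω_C = ω(−1)·ω_A` on the key `n₂ = n₃`, `n₂ + 2d ≤ n₁`.**  For an element datum `(α, β; n₁, n₂, n₃)` (so `|β − 1| = |ϖ|^{n₁}`) on a field with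
finite residue field, tokens `eA` of `α − 1` at depth `n₂` and `eC` of `β − α` at depth `n₃` (★ p860780 `heA` ∕ ★ p860897 `heC` verbatim), `n₂ = n₃ ≡ d (mod 2)` and `n₂ + 2d ≤ n₁`:
`normSign σ eC = normSign σ (−1) * normSign σ eA` — §1 RELATION III. [cite: Serre1979, Ch. V §3 Cor. 3] [cite: Rogawski1990, §4.9 p. 55] -/
theorem normSign_towerSign_eq_of_isElementDatum_of_deep₁ [Finite 𝓀[K]] (hD : IsRamifiedQuadraticDatum σ ϖ d t) (hE : IsElementDatum σ ϖ N₀ α β n₁ n₂ n₃)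
    (h23 : n₂ = n₃) (hdeep : n₂ + 2 * d ≤ n₁) (hpar : n₂ % 2 = d % 2)
    {eA eC : K} (hσeA : σ eA = eA) (heA1 : Valued.v eA = 1) (hσeC : σ eC = eC)
    (heA : Valued.v ((ϖ ^ mstarOfRecord d)⁻¹ * ((α - 1) * ((ϖ * σ ϖ) ^ ((n₂ - d % 2) / 2))⁻¹ - eA * ((ϖ - σ ϖ) * ((ϖ * σ ϖ) ^ ((d - d % 2) / 2))⁻¹))) ≤ 1)
    (heC : Valued.v ((ϖ ^ mstarOfRecord d)⁻¹ * ((β - α) * ((ϖ * σ ϖ) ^ ((n₃ - d % 2) / 2))⁻¹ - eC * ((ϖ - σ ϖ) * ((ϖ * σ ϖ) ^ ((d - d % 2) / 2))⁻¹))) ≤ 1) :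
    normSign σ eC = normSign σ (-1 : K) * normSign σ eA := by
  have hvβ : Valued.v (β - 1) ≤ Valued.v ϖ ^ n₁ := le_of_eq hE.2.2.2.2.2.1
  have hL : n₂ + 2 * d ≤ n₁ + 1 := by omega
  rw [← h23] at heC
  exact normSign_towerSign_sub_eq_neg_mul_of_snd_deep hD hvβ hL hpar hσeA heA1 hσeC heA heC

end ElementDatum

end Summit.HodgeConjecture.HodgeConjecture.Cruxes.H413.F0P3cDyRamTowerSignRelationsDeep

end
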